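import Mathlib
import Summits.Ventures.HodgeRepro.Tier4.Line1.HaarModulus

/-!
# Tier4/Line1/ModulusVecMul — the Haar modulus of `x ↦ x ᵥ* M` on `ι → R`: shears, diagonals, products, and the
image of the transvection–diagonal decomposition of a matrix over a field (Mathlib only)

Blind re-derivation cell `pub-hodge-repro`, Tier 4 (README §9–§10), seat t4-L2-p2 (gen 2), wall-breaker on the
cocompactness rung C5 of LINE L1 («the adelic modulus», t4-L1-p5's `I1c-rungs-sig.lean`).  Target tree path
`lean/Summits/Ventures/HodgeRepro/Tier4/Line1/ModulusVecMul.lean`.  Imports `HaarModulus` (the modulus of a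
continuous additive automorphism of a locally compact second countable abelian group; `modUnit`).

For a locally compact second countable topological commutative ring `R` and a finite index type `ι`, an invertible
matrix `M` acts on row vectors `x : ι → R` by `x ↦ x ᵥ* M` (`vecMulEquiv M : (ι → R) ≃ₜ+ (ι → R)`).  We say `M`
**has the determinant modulus** (`HasDetModulus μ ν M`) when the Haar modulus of this automorphism equals the modulus
`modUnit ν (det M)` of multiplication by `det M` on `R`.  Proved here: transvections have it (their modulus is `1`, a
shear preserves the product measure — Fubini), unit diagonal matrices have it (`measurePreserving_pi`), the property is
closed under products, inverses and list products, and — the step used place by place on the adele ring — for ANY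
non-unital ring homomorphism `s : F →ₙ+* R` from a field `F`, the image `embMat s M := 1 + (M - 1).map s` («`M` at the
place of `s`, the identity elsewhere») of every invertible `M : Matrix ι ι F` has it, by Mathlib's decomposition
`M = L · diagonal D · L′` into transvections and a diagonal matrix over the field `F`
(`Matrix.Pivot.exists_list_transvec_mul_diagonal_mul_list_transvec`).

Nothing here asserts anything about the Hodge conjecture for CM abelian varieties, which is NOT proved (HC_CM is NOT
proved by anyone in this repository).
-/

set_option autoImplicit false

noncomputable section

namespace Summit.Ventures.HodgeRepro.Tier4.Line1

open MeasureTheory Measure Topology Matrix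
open scoped ENNReal NNReal

section Algebra

variable {ι : Type*} [Fintype ι] [DecidableEq ι]
variable {R : Type*} [CommRing R]

/-- The determinant of an invertible matrix, as a unit of `R`. -/
def detUnit (M : (Matrix ι ι R)ˣ) : Rˣ := Units.map (detMonoidHom : Matrix ι ι R →* R) M

/-- The value of `detUnit` is the determinant. -/
@[simp]
theorem coe_detUnit (M : (Matrix ι ι R)ˣ) : (detUnit M : R) = det (M : Matrix ι ι R) := by
  simp [detUnit]

/-- `detUnit` is multiplicative. -/
theorem detUnit_mul (M N : (Matrix ι ι R)ˣ) : detUnit (M * N) = detUnit M * detUnit N := map_mul _ M N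

/-- `detUnit 1 = 1`. -/
theorem detUnit_one : detUnit (1 : (Matrix ι ι R)ˣ) = 1 := map_one _

/-- `detUnit` of the inverse. -/
theorem detUnit_inv (M : (Matrix ι ι R)ˣ) : detUnit M⁻¹ = (detUnit M)⁻¹ := map_inv _ M

/-- A transvection as a unit of the matrix ring (inverse: the opposite transvection). -/
def transvectionUnit (i j : ι) (hij : i ≠ j) (c : R) : (Matrix ι ι R)ˣ where
  val := transvection i j c
  inv := transvection i j (-c)
  val_inv := by rw [transvection_mul_transvection_same _ _ hij, add_neg_cancel, transvection_zero]
  inv_val := by rw [transvection_mul_transvection_same _ _ hij, neg_add_cancel, transvection_zero]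

/-- The value of `transvectionUnit`. -/
@[simp]
theorem coe_transvectionUnit (i j : ι) (hij : i ≠ j) (c : R) :
    (transvectionUnit i j hij c : Matrix ι ι R) = transvection i j c := rfl

/-- A transvection has determinant `1`. -/
theorem detUnit_transvectionUnit (i j : ι) (hij : i ≠ j) (c : R) : detUnit (transvectionUnit i j hij c) = 1 := by
  ext
  simp [det_transvection_of_ne i j hij]

/-- A diagonal matrix with unit entries as a unit of the matrix ring. -/
def diagonalUnit (u : ι → Rˣ) : (Matrix ι ι R)ˣ where
  val := diagonal fun l => (u l : R)
  inv := diagonal fun l => ((u l)⁻¹ : Rˣ)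
  val_inv := by rw [diagonal_mul_diagonal]; simp
  inv_val := by rw [diagonal_mul_diagonal]; simp

/-- The value of `diagonalUnit`. -/
@[simp]
theorem coe_diagonalUnit (u : ι → Rˣ) : (diagonalUnit u : Matrix ι ι R) = diagonal fun l => (u l : R) := rfl

/-- The determinant of a unit diagonal matrix is the product of its entries. -/
theorem detUnit_diagonalUnit (u : ι → Rˣ) : detUnit (diagonalUnit u) = ∏ l, u l := by
  ext
  simp [det_diagonal]

/-- The coordinates of `x ᵥ* transvection i j c`: the `j`-th coordinate is shifted by `x i * c`. -/
theorem vecMul_transvection_apply (i j : ι) (c : R) (x : ι → R) (l : ι) :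
    (x ᵥ* transvection i j c) l = x l + if l = j then x i * c else 0 := by
  rw [transvection, vecMul_add, vecMul_one, Pi.add_apply]
  congr 1
  simp only [vecMul, dotProduct, single_apply]
  by_cases hl : l = j
  · subst hl
    simp [mul_ite, Finset.sum_ite_eq]
  · simp [hl, Ne.symm hl]

end Algebra

section VecMulEquiv

variable {ι : Type*} [Fintype ι] [DecidableEq ι]
variable {R : Type*} [CommRing R] [TopologicalSpace R] [IsTopologicalRing R]

/-- **Right multiplication of row vectors by an invertible matrix** as a continuous additive automorphism of
`ι → R`. -/
def vecMulEquiv (M : (Matrix ι ι R)ˣ) : (ι → R) ≃ₜ+ (ι → R) where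
  toFun x := x ᵥ* (M : Matrix ι ι R)
  invFun x := x ᵥ* ((M⁻¹ : (Matrix ι ι R)ˣ) : Matrix ι ι R)
  left_inv x := by
    show x ᵥ* (M : Matrix ι ι R) ᵥ* ((M⁻¹ : (Matrix ι ι R)ˣ) : Matrix ι ι R) = x
    rw [vecMul_vecMul, Units.mul_inv, vecMul_one]
  right_inv x := by
    show x ᵥ* ((M⁻¹ : (Matrix ι ι R)ˣ) : Matrix ι ι R) ᵥ* (M : Matrix ι ι R) = x
    rw [vecMul_vecMul, Units.inv_mul, vecMul_one]
  map_add' x y := add_vecMul _ x y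
  continuous_toFun :=
    (continuous_id : Continuous fun x : ι → R => x).matrix_vecMul
      (continuous_const : Continuous fun _ : ι → R => (M : Matrix ι ι R))
  continuous_invFun :=
    (continuous_id : Continuous fun x : ι → R => x).matrix_vecMul
      (continuous_const : Continuous fun _ : ι → R => ((M⁻¹ : (Matrix ι ι R)ˣ) : Matrix ι ι R))

/-- `vecMulEquiv M x = x ᵥ* M`. -/
@[simp]
theorem vecMulEquiv_apply (M : (Matrix ι ι R)ˣ) (x : ι → R) : vecMulEquiv M x = x ᵥ* (M : Matrix ι ι R) := rfl

/-- `vecMulEquiv` of a product is the composite (in the row-vector order). -/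
theorem vecMulEquiv_mul (M N : (Matrix ι ι R)ˣ) :
    vecMulEquiv (M * N) = (vecMulEquiv M).trans (vecMulEquiv N) := by
  ext x
  simp [vecMul_vecMul]

/-- `vecMulEquiv 1` is the identity. -/
theorem vecMulEquiv_one : vecMulEquiv (1 : (Matrix ι ι R)ˣ) = ContinuousAddEquiv.refl (ι → R) := by
  ext x
  simp

/-- `vecMulEquiv M⁻¹` is the inverse automorphism. -/
theorem vecMulEquiv_inv (M : (Matrix ι ι R)ˣ) : vecMulEquiv M⁻¹ = (vecMulEquiv M).symm := by
  ext x
  rfl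

end VecMulEquiv

section Modulus

variable {ι : Type*} [Fintype ι] [DecidableEq ι]
variable {R : Type*} [CommRing R] [TopologicalSpace R] [IsTopologicalRing R] [LocallyCompactSpace R]
  [SecondCountableTopology R] [MeasurableSpace R] [BorelSpace R]
variable (μ : Measure (ι → R)) [μ.IsAddHaarMeasure] (ν : Measure R) [ν.IsAddHaarMeasure]

/-- **`M` has the determinant modulus**: the Haar modulus of `x ↦ x ᵥ* M` on `ι → R` is the modulus of
multiplication by `det M` on `R`. -/
def HasDetModulus (M : (Matrix ι ι R)ˣ) : Prop :=
  modulus μ (vecMulEquiv M) = modUnit ν (detUnit M)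

/-- `1` has the determinant modulus. -/
theorem hasDetModulus_one : HasDetModulus μ ν (1 : (Matrix ι ι R)ˣ) := by
  unfold HasDetModulus
  rw [vecMulEquiv_one, modulus_refl, detUnit_one, modUnit_one]

/-- `HasDetModulus` is closed under products. -/
theorem HasDetModulus.mul {M N : (Matrix ι ι R)ˣ} (hM : HasDetModulus μ ν M) (hN : HasDetModulus μ ν N) :
    HasDetModulus μ ν (M * N) := by
  unfold HasDetModulus at *
  rw [vecMulEquiv_mul, modulus_trans, hM, hN, detUnit_mul, modUnit_mul]

/-- `HasDetModulus` is closed under inverses. -/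
theorem HasDetModulus.inv {M : (Matrix ι ι R)ˣ} (hM : HasDetModulus μ ν M) : HasDetModulus μ ν M⁻¹ := by
  unfold HasDetModulus at *
  rw [vecMulEquiv_inv, modulus_symm, hM, detUnit_inv]
  exact (map_inv (modUnitHom ν) (detUnit M)).symm

/-- `HasDetModulus` is closed under list products. -/
theorem hasDetModulus_list_prod (L : List (Matrix ι ι R)ˣ) (h : ∀ M ∈ L, HasDetModulus μ ν M) :
    HasDetModulus μ ν L.prod := by
  induction L with
  | nil => simpa using hasDetModulus_one μ ν
  | cons M L ih =>
    rw [List.prod_cons]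
    exact (h M (by simp)).mul μ ν (ih fun N hN => h N (by simp [hN]))

/-- The product measure of `ν` on `ι → R` (a Haar measure). -/
abbrev piMeasure : Measure (ι → R) := Measure.pi fun _ : ι => ν

/-- A shear preserves the product measure (Fubini: the `j`-th factor is translated). -/
theorem measurePreserving_vecMul_transvection (i j : ι) (hij : i ≠ j) (c : R) :
    MeasurePreserving (fun x : ι → R => x ᵥ* transvection i j c) (piMeasure ν) (piMeasure ν) := by
  classical
  let p : ι → Prop := fun l => l ≠ j
  let E := MeasurableEquiv.piEquivPiSubtypeProd (fun _ : ι => R) p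
  have hE : MeasurePreserving E (piMeasure ν)
      ((Measure.pi fun _ : {l // p l} => ν).prod (Measure.pi fun _ : {l // ¬ p l} => ν)) :=
    measurePreserving_piEquivPiSubtypeProd (fun _ : ι => ν) p
  let g : ({l // p l} → R) → ({l // ¬ p l} → R) → ({l // ¬ p l} → R) :=
    fun u w => (fun _ => u ⟨i, hij⟩ * c) + w
  have hg : MeasurePreserving (fun q : ({l // p l} → R) × ({l // ¬ p l} → R) => (q.1, g q.1 q.2))
      ((Measure.pi fun _ : {l // p l} => ν).prod (Measure.pi fun _ : {l // ¬ p l} => ν))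
      ((Measure.pi fun _ : {l // p l} => ν).prod (Measure.pi fun _ : {l // ¬ p l} => ν)) := by
    refine MeasurePreserving.skew_product (MeasurePreserving.id _) ?_ ?_
    · have : Continuous (Function.uncurry g) := by
        simp only [g]
        exact (continuous_pi fun _ => ((continuous_apply _).comp continuous_fst).mul continuous_const).add
          continuous_snd
      exact this.measurable
    · exact Filter.Eventually.of_forall fun u => map_add_left_eq_self _ _
  have key : (fun x : ι → R => x ᵥ* transvection i j c) =
      E.symm ∘ (fun q : ({l // p l} → R) × ({l // ¬ p l} → R) => (q.1, g q.1 q.2)) ∘ E := by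
    funext x
    funext l
    rw [vecMul_transvection_apply]
    simp only [Function.comp, E, g, MeasurableEquiv.piEquivPiSubtypeProd, MeasurableEquiv.coe_mk,
      Equiv.piEquivPiSubtypeProd_apply, MeasurableEquiv.symm_mk, Equiv.piEquivPiSubtypeProd_symm_apply,
      Pi.add_apply]
    by_cases hl : l = j
    · subst hl
      simp [p, add_comm]
    · simp [p, hl]
  rw [key]
  exact (hE.symm E).comp (hg.comp hE)

include ν in
/-- The modulus of a transvection is `1` (proved against the product measure of any Haar measure `ν` on `R`). -/
theorem modulus_vecMulEquiv_transvectionUnit (i j : ι) (hij : i ≠ j) (c : R) :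
    modulus μ (vecMulEquiv (transvectionUnit i j hij c)) = 1 := by
  apply modulus_eq_of_map_eq_smul' μ (piMeasure ν)
  rw [one_smul]
  exact (measurePreserving_vecMul_transvection ν i j hij c).map_eq

/-- A transvection has the determinant modulus. -/
theorem hasDetModulus_transvectionUnit (i j : ι) (hij : i ≠ j) (c : R) :
    HasDetModulus μ ν (transvectionUnit i j hij c) := by
  unfold HasDetModulus
  rw [modulus_vecMulEquiv_transvectionUnit μ ν, detUnit_transvectionUnit, modUnit_one]

/-- A unit diagonal matrix pushes the product measure to the product of the rescaled factors. -/
theorem measurePreserving_vecMul_diagonal (u : ι → Rˣ) :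
    MeasurePreserving (fun x : ι → R => x ᵥ* diagonal fun l => (u l : R)) (piMeasure ν)
      (Measure.pi fun l => modUnit ν (u l) • ν) := by
  have h : (fun x : ι → R => x ᵥ* diagonal fun l => (u l : R)) = fun (x : ι → R) (l : ι) => x l * (u l : R) := by
    funext x l
    exact vecMul_diagonal _ _ _
  rw [h]
  exact measurePreserving_pi _ _ fun l =>
    ⟨(continuous_mul_const _).measurable, map_eq_modulus_smul ν (mulRightEquiv (u l))⟩

omit [DecidableEq ι] [BorelSpace R] in
/-- The product measure of rescaled factors is the rescaled product measure. -/
theorem pi_nnreal_smul (c : ι → ℝ≥0) :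
    (Measure.pi fun l => c l • ν) = (∏ l, c l) • piMeasure ν := by
  refine Measure.pi_eq fun s _ => ?_
  simp only [Measure.smul_apply, piMeasure, Measure.pi_pi, ENNReal.smul_def, smul_eq_mul,
    ENNReal.ofNNReal_finsetProd, Finset.prod_mul_distrib]

/-- The modulus of a unit diagonal matrix is the product of the moduli of its entries. -/
theorem modulus_vecMulEquiv_diagonalUnit (u : ι → Rˣ) :
    modulus μ (vecMulEquiv (diagonalUnit u)) = ∏ l, modUnit ν (u l) := by
  apply modulus_eq_of_map_eq_smul' μ (piMeasure ν)
  rw [← pi_nnreal_smul]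
  exact (measurePreserving_vecMul_diagonal ν u).map_eq

/-- A unit diagonal matrix has the determinant modulus. -/
theorem hasDetModulus_diagonalUnit (u : ι → Rˣ) : HasDetModulus μ ν (diagonalUnit u) := by
  unfold HasDetModulus
  rw [modulus_vecMulEquiv_diagonalUnit μ ν, detUnit_diagonalUnit]
  exact (map_prod (modUnitHom ν) u Finset.univ).symm

end Modulus

end Summit.Ventures.HodgeRepro.Tier4.Line1

end
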